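import Summits.BirchSwinnertonDyer.BirchSwinnertonDyer.Theorems.KolyvaginRoadThreeSchneiderTamAtThreeHeightLogNumeratorSplitChecker
import Summits.BirchSwinnertonDyer.BirchSwinnertonDyer.Theorems.KolyvaginRoadThreeSchneiderTamAtThreeHeightLogNumeratorCriterion
import Summits.BirchSwinnertonDyer.BirchSwinnertonDyer.Theorems.Rank1ResidualIntModelReduction
import HarnessLib

/-!
# The split `3`-adic height — the FIRST-ORDER SPLIT ROW CHECKER AT `p = 3` (the 961 split ∧ (ram) X11b@3 classes of
# the cell's D-f ask) and two rows of record (`173922m1`, type `I₂`; `111930bc1`, type `I₁`)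

HONEST FRAMING (cell `bsd-stepL`, seat `bsd-stepL-tam3-p2` g4; `--supports stmt-BirchSwinnertonDyer-19154 --as helper`):
THEOREMS ONLY; 0 definitions, 0 named facts, 0 sorry; ONE curve per application. Imports part 4 of the seat's chain
(`…HeightLogNumeratorCriterion`, the `p = 3` first-order law `‖ĥ_{4.1}(P) − log₃ num x‖₃ ≤ ‖x‖₃⁻¹`, whose module sits in the
cone of route `KolyvaginRoadThree` — cone lint known; the split law itself is route-free, files `…Split`, `…SplitChecker`).
Nothing class-wide is claimed: on the split locus at `3` the two `p = 3` routes use the BDP road (`HalvesTam…`), not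
Schneider; the per-pair split certificate is the input `hc : RegMult.CertSplit W 3 P m` of the LINE-PUBLISHED exz-road
supplier `Three.missingUpperBoundAt_of_surj_split_of_certSplit_of_conjecture` (p545447; RULING 34: road not opened),
numerically CERT on 960/961 classes (lane A v2) and now decidable in the kernel by ONE pair of integer congruences
wherever the first-order criterion fires (416/961 tabulated points: valuation form 297, digit form 119 — the digit
form is not in this file; 354 of the 447 silent rows are points `Q = 3Q'` forced by `3 ∣ c_ℓ`, cured by re-tabulating at
a `3`-free multiple where one exists, else by the second-order law). EVIDENCE `SPLIT-LAW-CHECK.md` + `SPLIT3-ROWS.tsv`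
on 19154.

* `mult_three_of_model` — `Mult W 3` from `3 ∣ Δ`, `3 ∤ c₄` on the integer equation (lane `IntModel`).
* `heightSplitCoord_ne_zero_of_row_three`, `certSplit_of_row_three`, `schneiderHalf_split_of_row_three` — the
  `p = 3` twins of `…SplitChecker` (`‖·‖₃`-law from part 4; `p − 1 = 2`, `6(p − 1) = 12`).
* `certSplit_173922m1`, `certSplit_111930bc1` — rows of record (smallest firing rows of each valuation case,
  `τ < α` with `ν = 2` and `α < τ` with `ν = 1`).

References: [SteinWuthrich2013] §4.2 (p. 16); [SilvermanAEC2009] VII.2.1, VII.5 Prop. 5.1(b); [SilvermanATAEC1994]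
Thm. V.3.1(b), Lemma V.5.1; [Iwasawa1972PadicL] §4.4; [Cremona1997] Table 1.
-/

noncomputable section

open scoped Classical
open Filter Topology IsUltrametricDist
open WeierstrassCurve Literature.NumberTheory.EllipticCurves
open Literature.NumberTheory.EllipticCurves.SteinWuthrich2013
open Literature.NumberTheory.EllipticCurves.TateCurve
open Literature.NumberTheory.EllipticCurves.Rank1Residual
open Summit.BirchSwinnertonDyer.Uniform.UI.O2
open Summit.BirchSwinnertonDyer.Rank1Residual Summit.BirchSwinnertonDyer.Rank1Residual.X11b
open Summit.BirchSwinnertonDyer.BirchSwinnertonDyer.Rank1Residual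

namespace Summit.BirchSwinnertonDyer.Rank1Residual.X11b.RegMult.HeightLogNumerator

/-! ### §5 The `p = 3` checker -/

section Three

/-- **`Mult W 3` from the integer equation**: `W = ⟨a₁,…,a₆⟩` globally minimal with `3 ∣ Δ` and `3 ∤ c₄` (integer
formulas) has multiplicative reduction at `3` (Silverman AEC VII.5.1(b); lane `IntModel.hasMultiplicativeReductionAtPrime_of_intModel`).
[cite: SilvermanAEC2009, VII.5 Prop. 5.1(b)] -/
theorem mult_three_of_model (W : WeierstrassCurve ℚ) {a₁ a₂ a₃ a₄ a₆ : ℤ} (hW : W = ⟨a₁, a₂, a₃, a₄, a₆⟩)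
    [W.IsElliptic] [W.IsGloballyMinimal] {c4 D : ℤ}
    (H : c4 = (a₁ ^ 2 + 4 * a₂) ^ 2 - 24 * (2 * a₄ + a₁ * a₃) ∧
      D = -(a₁ ^ 2 + 4 * a₂) ^ 2 * (a₁ ^ 2 * a₆ + 4 * a₂ * a₆ - a₁ * a₃ * a₄ + a₂ * a₃ ^ 2 - a₄ ^ 2) -
        8 * (2 * a₄ + a₁ * a₃) ^ 3 - 27 * (a₃ ^ 2 + 4 * a₆) ^ 2 +
        9 * (a₁ ^ 2 + 4 * a₂) * (2 * a₄ + a₁ * a₃) * (a₃ ^ 2 + 4 * a₆) ∧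
      (3 : ℤ) ∣ D ∧ ¬ (3 : ℤ) ∣ c4) : Mult W 3 := by
  obtain ⟨hc4, hD, h3D, h3c4⟩ := H
  have hI : integralModelInt W = (⟨a₁, a₂, a₃, a₄, a₆⟩ : WeierstrassCurve ℤ) :=
    IntModel.integralModelInt_eq_of_map_eq _ (by rw [IntModel.map_mk_int, hW])
  refine IntModel.hasMultiplicativeReductionAtPrime_of_intModel hI 3 ?_ ?_
  · have e : (⟨a₁, a₂, a₃, a₄, a₆⟩ : WeierstrassCurve ℤ).Δ = D := by
      rw [hD]; simp only [WeierstrassCurve.Δ, WeierstrassCurve.b₂, WeierstrassCurve.b₄, WeierstrassCurve.b₆,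
        WeierstrassCurve.b₈]
    rw [e]; exact_mod_cast h3D
  · have e : (⟨a₁, a₂, a₃, a₄, a₆⟩ : WeierstrassCurve ℤ).c₄ = c4 := by
      rw [hc4]; simp only [WeierstrassCurve.c₄, WeierstrassCurve.b₂, WeierstrassCurve.b₄]
    rw [e]; exact_mod_cast h3c4

/-- **First-order split ROW CHECKER at `p = 3` (value form)**: as `heightSplitCoord_ne_zero_of_row_padic` with the
`3`-adic first-order law of part 4 (`norm_heightFourOneCoord_sub_padicLog_num_le`); `a^{p−1} − 1 = a² − 1`,
`U^{p−1} − c₄^{6(p−1)} = U² − c₄¹²`. [cite: SteinWuthrich2013, §4.2] [cite: Iwasawa1972PadicL, §4.4] -/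
theorem heightSplitCoord_ne_zero_of_row_three (W : WeierstrassCurve ℚ) {a₁ a₂ a₃ a₄ a₆ : ℤ}
    (hW : W = ⟨a₁, a₂, a₃, a₄, a₆⟩) [W.IsElliptic] [W.IsGloballyMinimal] (hWm : Mult W 3)
    {a c4 Dp U NL : ℤ} {e' k ν vL α : ℕ}
    (H : ¬ 3 ∣ e' ∧ 1 ≤ k ∧ Nat.Coprime a.natAbs (3 ^ k * e') ∧
      c4 = (a₁ ^ 2 + 4 * a₂) ^ 2 - 24 * (2 * a₄ + a₁ * a₃) ∧
      (3 : ℤ) ^ ν * Dp = -(a₁ ^ 2 + 4 * a₂) ^ 2 * (a₁ ^ 2 * a₆ + 4 * a₂ * a₆ - a₁ * a₃ * a₄ + a₂ * a₃ ^ 2 - a₄ ^ 2) -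
        8 * (2 * a₄ + a₁ * a₃) ^ 3 - 27 * (a₃ ^ 2 + 4 * a₆) ^ 2 +
        9 * (a₁ ^ 2 + 4 * a₂) * (2 * a₄ + a₁ * a₃) * (a₃ ^ 2 + 4 * a₆) ∧
      ¬ (3 : ℤ) ∣ c4 ∧ ¬ (3 : ℤ) ∣ Dp ∧
      U = Dp * c4 ^ 3 + 744 * (3 : ℤ) ^ ν * Dp ^ 2 ∧ NL = U ^ 2 - c4 ^ 12 ∧
      (3 : ℤ) ^ vL ∣ NL ∧ ¬ (3 : ℤ) ^ (vL + 1) ∣ NL ∧ vL < 2 * ν ∧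
      (3 : ℤ) ^ α ∣ a ^ 2 - 1 ∧ ¬ (3 : ℤ) ^ (α + 1) ∣ a ^ 2 - 1 ∧ α + vL ≠ 2 * k)
    {x y : ℚ} (hx : x = a / ((3 ^ k * e' : ℕ) : ℚ) ^ 2) (hP : W.toAffine.Equation x y)
    {q : ℚ_[3]} (hq0 : q ≠ 0) (hq : ‖q‖ < 1) (hj : tateJ q = (W.j : ℚ_[3])) :
    heightSplitCoord W 3 q x y ≠ 0 := by
  obtain ⟨hpe', hk, hcop, hc4, hD, hpc4, hpDp, hU, hNL, h1, h2, hvL, hα1, hα2, hcrit⟩ := H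
  have hp1 : (1 : ℝ) < (3 : ℕ) := by norm_num
  have hpR0 : ((3 : ℕ) : ℝ) ≠ 0 := by norm_num
  have he'0 : e' ≠ 0 := by rintro rfl; exact hpe' (dvd_zero 3)
  have he0 : (3 ^ k * e' : ℕ) ≠ 0 := Nat.mul_ne_zero (pow_ne_zero _ (by norm_num)) he'0
  have hpe : 3 ∣ 3 ^ k * e' := dvd_mul_of_dvd_left (dvd_pow_self 3 (by omega)) _
  have h : W.toAffine.Nonsingular x y :=
    (WeierstrassCurve.Affine.equation_iff_nonsingular (W := W.toAffine)).mp hP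
  have hx1 : 1 < ‖(x : ℚ_[3])‖ :=
    (one_lt_norm_ratCast_iff 3 x).mpr (KernelCert.padicValRat_x_neg he0 hx hcop hpe)
  have hpa : ¬ ((3 : ℕ) : ℤ) ∣ a := by
    intro hd
    have h1' : 3 ∣ a.natAbs := Int.natCast_dvd.mp hd
    have h2' : 3 ∣ Nat.gcd a.natAbs (3 ^ k * e') := Nat.dvd_gcd h1' hpe
    rw [hcop] at h2'
    omega
  set e : ℕ := 3 ^ k * e' with hedef
  have hcop2 : Nat.Coprime a.natAbs (((e : ℤ) ^ 2).natAbs) := by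
    rw [Int.natAbs_pow, Int.natAbs_natCast]; exact hcop.pow_right 2
  have he2pos : (0 : ℤ) < (e : ℤ) ^ 2 := by positivity
  have hxq : x = ((a : ℤ) : ℚ) / (((e : ℤ) ^ 2 : ℤ) : ℚ) := by rw [hx]; push_cast; ring
  have hnum : x.num = a := by rw [hxq]; exact Rat.num_div_eq_of_coprime he2pos hcop2
  have hxinv : ‖(x : ℚ_[3])‖⁻¹ = ((3 : ℕ) : ℝ) ^ (-((2 * k : ℕ) : ℤ)) := by
    have hxp : (x : ℚ_[3]) = (a : ℚ_[3]) / (((3 : ℕ) : ℚ_[3]) ^ k * (e' : ℚ_[3])) ^ 2 := by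
      rw [hx, hedef]; push_cast; ring
    have he'n : ‖(e' : ℚ_[3])‖ = 1 := by
      rw [show (e' : ℚ_[3]) = ((e' : ℤ) : ℚ_[3]) by norm_cast]
      exact BinaryQuartic.norm_intCast_eq_one (fun hd => hpe' (by exact_mod_cast hd))
    rw [hxp, norm_div, BinaryQuartic.norm_intCast_eq_one hpa, norm_pow, norm_mul, norm_pow, Padic.norm_p, he'n,
      mul_one, one_div, inv_inv, ← zpow_natCast, ← zpow_natCast, ← zpow_mul, inv_zpow']
    congr 1; push_cast; ring
  have hla : ‖padicLog 3 ((x.num : ℚ) : ℚ_[3])‖ = ((3 : ℕ) : ℝ) ^ (-(α : ℤ)) := by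
    rw [hnum, Rat.cast_intCast, norm_padicLog_intCast_eq (p := 3) (by norm_num) hpa]
    have e1 : ((a : ℚ_[3])) ^ (3 - 1) - 1 = ((a ^ 2 - 1 : ℤ) : ℚ_[3]) := by push_cast; ring
    rw [e1, GaloisImage.PadicSquareClass.norm_intCast_padic_eq hα1 hα2]
  have hNL' : NL = U ^ (3 - 1) - c4 ^ (6 * (3 - 1)) := by rw [hNL]
  have hL : ‖padicLog 3 q‖ = ((3 : ℕ) : ℝ) ^ (-(vL : ℤ)) :=
    norm_padicLog_tateParam_eq_of_model (p := 3) (by norm_num) W hW hc4 (by exact_mod_cast hD) (by exact_mod_cast hpc4)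
      (by exact_mod_cast hpDp) (by rw [hU]; push_cast; ring) hNL' (by exact_mod_cast h1) (by exact_mod_cast h2) hvL
      hq0 hq hj
  have hL0 : padicLog 3 q ≠ 0 := norm_pos_iff.mp (by rw [hL]; positivity)
  refine heightSplitCoord_ne_zero_of_norm_ne (p := 3) (by norm_num) hWm hq0 hq hL0 h hx1
    (norm_heightFourOneCoord_sub_padicLog_num_le hWm hq h hx1) ?_
  rw [hla, hxinv, hL, ← zpow_sub₀ hpR0]
  intro heq
  have := zpow_right_injective₀ (by positivity) hp1.ne' heq
  push_cast at this
  omega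

/-- **`RegMult.CertSplit W 3 Q 1` from the `p = 3` row checker** (+ the gcd admissibility test). ONE curve per
application; nothing class-wide. [cite: SteinWuthrich2013, §4.2] [cite: SilvermanAEC2009, VII.2.1] [cite: MazurSteinTate2006, §1] -/
theorem certSplit_of_row_three (W : WeierstrassCurve ℚ) {a₁ a₂ a₃ a₄ a₆ : ℤ}
    (hW : W = ⟨a₁, a₂, a₃, a₄, a₆⟩) [W.IsElliptic] [W.IsGloballyMinimal] (hWm : Mult W 3)
    {a b c4 Dp U NL : ℤ} {e' k n ν vL α : ℕ}
    (H : ¬ 3 ∣ e' ∧ 1 ≤ k ∧ Nat.Coprime a.natAbs (3 ^ k * e') ∧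
      Int.gcd (2 * b + a₁ * a * (3 ^ k * e' : ℕ) + a₃ * (3 ^ k * e' : ℕ) ^ 3)
        (a₁ * b * (3 ^ k * e' : ℕ) - (3 * a ^ 2 + 2 * a₂ * a * (3 ^ k * e' : ℕ) ^ 2 + a₄ * (3 ^ k * e' : ℕ) ^ 4))
        ∣ (3 ^ k * e') ^ n ∧
      c4 = (a₁ ^ 2 + 4 * a₂) ^ 2 - 24 * (2 * a₄ + a₁ * a₃) ∧
      (3 : ℤ) ^ ν * Dp = -(a₁ ^ 2 + 4 * a₂) ^ 2 * (a₁ ^ 2 * a₆ + 4 * a₂ * a₆ - a₁ * a₃ * a₄ + a₂ * a₃ ^ 2 - a₄ ^ 2) -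
        8 * (2 * a₄ + a₁ * a₃) ^ 3 - 27 * (a₃ ^ 2 + 4 * a₆) ^ 2 +
        9 * (a₁ ^ 2 + 4 * a₂) * (2 * a₄ + a₁ * a₃) * (a₃ ^ 2 + 4 * a₆) ∧
      ¬ (3 : ℤ) ∣ c4 ∧ ¬ (3 : ℤ) ∣ Dp ∧
      U = Dp * c4 ^ 3 + 744 * (3 : ℤ) ^ ν * Dp ^ 2 ∧ NL = U ^ 2 - c4 ^ 12 ∧
      (3 : ℤ) ^ vL ∣ NL ∧ ¬ (3 : ℤ) ^ (vL + 1) ∣ NL ∧ vL < 2 * ν ∧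
      (3 : ℤ) ^ α ∣ a ^ 2 - 1 ∧ ¬ (3 : ℤ) ^ (α + 1) ∣ a ^ 2 - 1 ∧ α + vL ≠ 2 * k)
    {x y : ℚ} (hx : x = a / ((3 ^ k * e' : ℕ) : ℚ) ^ 2) (hy : y = b / ((3 ^ k * e' : ℕ) : ℚ) ^ 3)
    (h : W.toAffine.Nonsingular x y) :
    RegMult.CertSplit W 3 (.some x y h) 1 := by
  obtain ⟨hpe', hk, hcop, hgcd, hc4, hD, hpc4, hpDp, hU, hNL, h1, h2, hvL, hα1, hα2, hcrit⟩ := H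
  have he'0 : e' ≠ 0 := by rintro rfl; exact hpe' (dvd_zero 3)
  have he0 : (3 ^ k * e' : ℕ) ≠ 0 := Nat.mul_ne_zero (pow_ne_zero _ (by norm_num)) he'0
  have hpe : 3 ∣ 3 ^ k * e' := dvd_mul_of_dvd_left (dvd_pow_self 3 (by omega)) _
  have hx1 : 1 < ‖(x : ℚ_[3])‖ :=
    (one_lt_norm_ratCast_iff 3 x).mpr (KernelCert.padicValRat_x_neg he0 hx hcop hpe)
  have hadm : W.IsAdmissible 3 (.some x y h) :=
    isAdmissible_of_one_lt_norm (by norm_num) h hx1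
      (KernelCert.hasNonsingularReductionAt_of_gcd W hW he0 hx hy hcop hgcd)
  refine ⟨by rw [one_nsmul]; exact hadm, fun Dq => ?_⟩
  rw [one_nsmul]
  show heightSplitCoord W 3 Dq.q x y ≠ 0
  exact heightSplitCoord_ne_zero_of_row_three W hW hWm
    ⟨hpe', hk, hcop, hc4, hD, hpc4, hpDp, hU, hNL, h1, h2, hvL, hα1, hα2, hcrit⟩ hx h.left
    Dq.q_ne_zero Dq.norm_q_lt_one Dq.tateJ_eq

/-- **The `.2` (split) half of `ClassClosure.RegulatorNonvanishingAt W 3` from one row, modulo GZK on class X11b at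
`3`** — the per-pair `hSchS`-type input on the split locus (`RegMult.schneiderHalf_split_of_cert`). ONE curve;
CONDITIONAL on GZK by name; closes nothing by itself. [cite: SteinWuthrich2013, §4.2] [cite: KolyvaginEulerSystems1990, Thm. A] -/
theorem schneiderHalf_split_of_row_three (hGZK : rank_eq_analyticRank_of_analyticRank_le_one)
    (W : WeierstrassCurve ℚ) {a₁ a₂ a₃ a₄ a₆ : ℤ} (hW : W = ⟨a₁, a₂, a₃, a₄, a₆⟩) [W.IsElliptic]
    [W.IsGloballyMinimal] (hX : ClassX11b W 3) {a b c4 Dp U NL : ℤ} {e' k n ν vL α : ℕ}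
    (H : ¬ 3 ∣ e' ∧ 1 ≤ k ∧ Nat.Coprime a.natAbs (3 ^ k * e') ∧
      Int.gcd (2 * b + a₁ * a * (3 ^ k * e' : ℕ) + a₃ * (3 ^ k * e' : ℕ) ^ 3)
        (a₁ * b * (3 ^ k * e' : ℕ) - (3 * a ^ 2 + 2 * a₂ * a * (3 ^ k * e' : ℕ) ^ 2 + a₄ * (3 ^ k * e' : ℕ) ^ 4))
        ∣ (3 ^ k * e') ^ n ∧
      c4 = (a₁ ^ 2 + 4 * a₂) ^ 2 - 24 * (2 * a₄ + a₁ * a₃) ∧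
      (3 : ℤ) ^ ν * Dp = -(a₁ ^ 2 + 4 * a₂) ^ 2 * (a₁ ^ 2 * a₆ + 4 * a₂ * a₆ - a₁ * a₃ * a₄ + a₂ * a₃ ^ 2 - a₄ ^ 2) -
        8 * (2 * a₄ + a₁ * a₃) ^ 3 - 27 * (a₃ ^ 2 + 4 * a₆) ^ 2 +
        9 * (a₁ ^ 2 + 4 * a₂) * (2 * a₄ + a₁ * a₃) * (a₃ ^ 2 + 4 * a₆) ∧
      ¬ (3 : ℤ) ∣ c4 ∧ ¬ (3 : ℤ) ∣ Dp ∧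
      U = Dp * c4 ^ 3 + 744 * (3 : ℤ) ^ ν * Dp ^ 2 ∧ NL = U ^ 2 - c4 ^ 12 ∧
      (3 : ℤ) ^ vL ∣ NL ∧ ¬ (3 : ℤ) ^ (vL + 1) ∣ NL ∧ vL < 2 * ν ∧
      (3 : ℤ) ^ α ∣ a ^ 2 - 1 ∧ ¬ (3 : ℤ) ^ (α + 1) ∣ a ^ 2 - 1 ∧ α + vL ≠ 2 * k)
    {x y : ℚ} (hx : x = a / ((3 ^ k * e' : ℕ) : ℚ) ^ 2) (hy : y = b / ((3 ^ k * e' : ℕ) : ℚ) ^ 3)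
    (h : W.toAffine.Nonsingular x y) :
    ∀ (Dq : TateParameterData W 3) (Dh : PAdicHeightData W 3),
      IsSplitMultCanonical Dh Dq → SchneiderConjecture Dh :=
  RegMult.schneiderHalf_split_of_cert (mordellWeilRank_eq_one_of_analyticRank hGZK hX.1)
    (certSplit_of_row_three W hW hX.2.2.1 H hx hy h)

end Three

/-! ### §6 Two rows of record -/

section Rows

/-- **Cremona `173922m1` at the split prime `3`** (`[1,0,1,4,92]`, `N = 173922`, Kodaira type `I_2` at `3`):
lane A's tabulated point `Q = 2·P = (-32/9, -124/27)` (`P = (2, 9)`, REG3CERT/v2 row `173922m1@3`, kit j249895)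
has level `k = 1`, `3^1 ∥ a² − 1`, `v_L = 2` — so `α + v_L = 3 ≠ 2 = 2k` and **`RegMult.CertSplit W 3 Q 1`**
(`‖ĥ₃^{split}(Q)‖₃ = 3^{−min(α, 2k − v_L)} = 3^{-0}`; lane A's 48-digit value has `v₃ = 0`). ONE curve; nothing
class-wide; the exz-road supplier `Three.missingUpperBoundAt_of_surj_split_of_certSplit_of_conjecture` consumes it.
[cite: SteinWuthrich2013, §4.2] [cite: Cremona1997, Table 1 (curve 173922m1)] -/
theorem certSplit_173922m1 (W : WeierstrassCurve ℚ) (hW : W = ⟨1, 0, 1, 4, 92⟩) [W.IsElliptic]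
    [W.IsGloballyMinimal] :
    ∃ h : W.toAffine.Nonsingular ((-32 : ℚ) / 9) ((-124 : ℚ) / 27), RegMult.CertSplit W 3 (.some _ _ h) 1 := by
  have hP : W.toAffine.Equation ((-32 : ℚ) / 9) ((-124 : ℚ) / 27) := by
    subst hW; rw [WeierstrassCurve.Affine.equation_iff]; norm_num
  refine ⟨(WeierstrassCurve.Affine.equation_iff_nonsingular (W := W.toAffine)).mp hP, ?_⟩
  exact certSplit_of_row_three W hW (mult_three_of_model W hW (c4 := -215) (D := -3652362) (by norm_num))
    (a := -32) (b := -124) (c4 := -215) (Dp := -405818) (U := 1106785687600054)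
    (NL := 1215218789038711392922610412291)
    (e' := 1) (k := 1) (n := 0) (ν := 2) (vL := 2) (α := 1) (by norm_num) (by norm_num) (by norm_num) _

/-- **Cremona `111930bc1` at the split prime `3`** (`[1,0,1,-53,-544]`, `N = 111930`, Kodaira type `I_1` at `3`):
lane A's tabulated point `Q = 2·P = (7684/729, 84932/19683)` (`P = (32, 159)`, REG3CERT/v2 row `111930bc1@3`, kit j249895)
has level `k = 3`, `3^1 ∥ a² − 1`, `v_L = 1` — so `α + v_L = 2 ≠ 6 = 2k` and **`RegMult.CertSplit W 3 Q 1`**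
(`‖ĥ₃^{split}(Q)‖₃ = 3^{−min(α, 2k − v_L)} = 3^{-1}`; lane A's 48-digit value has `v₃ = 1`). ONE curve; nothing
class-wide; the exz-road supplier `Three.missingUpperBoundAt_of_surj_split_of_certSplit_of_conjecture` consumes it.
[cite: SteinWuthrich2013, §4.2] [cite: Cremona1997, Table 1 (curve 111930bc1)] -/
theorem certSplit_111930bc1 (W : WeierstrassCurve ℚ) (hW : W = ⟨1, 0, 1, -53, -544⟩) [W.IsElliptic]
    [W.IsGloballyMinimal] :
    ∃ h : W.toAffine.Nonsingular ((7684 : ℚ) / 729) ((84932 : ℚ) / 19683), RegMult.CertSplit W 3 (.some _ _ h) 1 := by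
  have hP : W.toAffine.Equation ((7684 : ℚ) / 729) ((84932 : ℚ) / 19683) := by
    subst hW; rw [WeierstrassCurve.Affine.equation_iff]; norm_num
  refine ⟨(WeierstrassCurve.Affine.equation_iff_nonsingular (W := W.toAffine)).mp hP, ?_⟩
  exact certSplit_of_row_three W hW (mult_three_of_model W hW (c4 := 2521) (D := -116407200) (by norm_num))
    (a := 7684) (b := 84932) (c4 := 2521) (Dp := -38802400) (U := 2738863137249293600)
    (NL := -65890789071692764963949236348777689556641)
    (e' := 1) (k := 3) (n := 0) (ν := 1) (vL := 1) (α := 1) (by norm_num) (by norm_num) (by norm_num) _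

end Rows

end Summit.BirchSwinnertonDyer.Rank1Residual.X11b.RegMult.HeightLogNumerator

end
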